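import Summits.CriticalPhenomena.CardyFormulaZ2.Theses.CardySelfRefinement
import Summits.CriticalPhenomena.CardyFormulaZ2.Theorems.CardySelfRefinementLagHandOffQuadCompactness
import Literature.Probability.Percolation.QuadCrossingSubseqLimits
import HarnessLib

/-!
# `LagHandOff` (route `CardySelfRefinement`, stmt-CriticalPhenomena-10268): logical shape of the
# crux and the CLOSED vacuity channels of its antecedents

Structural lemmas of the standing adversary (refuter `cdisprove`, cycles 1–4) for the crux

  `LagHandOff : RotationInput → ScaleInvariantLimits → (i) ∧ (ii)`,

(i) = eventual a.e.-measurability of the bond-`ℤ²` exploration interfaces of every admissible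
discretisation family, (ii) = along every positive mesh sequence `δₙ → 0` ONE subsequence and ONE
local Markov chordal family `P`, a.s. tracing no boundary arc, to which the interfaces of every
`(D, E)` converge in law.

* `lagHandOff_clause_i` — clause (i) holds OUTRIGHT (no hypothesis): at positive mesh the
  interface factors through the finitely many edge coordinates of `Ω_δ`
  (`measurable_bondInterfaceIn`).  Hence `lagHandOff_iff_clauseII`: the crux is
  `RotationInput → ScaleInvariantLimits → (ii)`, and `not_lagHandOff_iff_clauseII`: a refutation
  must PROVE both antecedents and refute (ii).
* `rotationInput_and_scaleInvariantLimits_of_eq_empty` / `…_of_forall_eq_zero` — the two JUNK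
  regimes in which the antecedents would hold for free (`Λ = subseqQuadLimits univ` empty, or
  consisting of zero laws); `subseqQuadLimits_nonempty`, `ne_zero_of_mem_subseqQuadLimits` — both
  regimes are EXCLUDED by theorems (Schramm–Smirnov Cor. 1.6 via the landed
  `exists_mem_subseqQuadLimits_tendsto_subseq`; `isProbabilityMeasure_of_isSubseqQuadLimit`).  So
  the antecedents are genuine statements and `¬ LagHandOff` is at least as hard as PROVING scale
  invariance of the bond-`ℤ²` subsequential limits — the structural reason the crux resists a Lean
  disproof.
* `arcFamily_violates_noTracing` — the no-tracing clause of (ii) has teeth: the chordal,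
  similarity-covariant boundary runner `ChordalFamily.arcFamily` violates it in every domain.

Companions: `Negative/Guards.lean` (the two load-bearing guards of (ii)),
`Negative/KillTemplates.lean` (persistent lattice discrepancies that would refute the crux).
The work file with the full analysis is `Cruxes/LagHandOff/Disproof.lean`.
-/

noncomputable section

open MeasureTheory Filter Set Topology
open Literature.Probability.Percolation Literature.Probability.LatticeModels
open Literature.Probability.RandomPlanarGeometry Literature.Probability.Percolation.QuadCrossing
open Summit.CriticalPhenomena.CardyFormulaZ2.Theses.CardySelfRefinement

namespace Summit.CriticalPhenomena.CardyFormulaZ2.Theorems.LagHandOff.Negative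

/-! ### Clause (i) holds outright -/

/-- The boundary-condition-completed configuration only reads the edges of `Ω_δ`. [folklore] -/
theorem bcBondConfig_inter_eq (E : DiscreteDobrushin) {S : Set (Sym2 (Site 2))}
    (hS : (discreteDomainGraph E.Ω E.δ).edgeSet ⊆ S) (ω : BondConfig (Site 2)) :
    E.bcBondConfig (ω ∩ S) = E.bcBondConfig ω := by
  ext e
  simp only [DiscreteDobrushin.mem_bcBondConfig_iff, Set.mem_inter_iff]
  constructor
  · rintro ⟨he, h | ⟨⟨hω, -⟩, hB⟩⟩
    · exact ⟨he, Or.inl h⟩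
    · exact ⟨he, Or.inr ⟨hω, hB⟩⟩
  · rintro ⟨he, h | ⟨hω, hB⟩⟩
    · exact ⟨he, Or.inl h⟩
    · exact ⟨he, Or.inr ⟨⟨hω, hS he⟩, hB⟩⟩

/-- Exploration paths only depend on the completed configuration. [folklore] -/
theorem isMedialExploration_congr (E : DiscreteDobrushin) {ω ω' : BondConfig (Site 2)}
    (h : E.bcBondConfig ω = E.bcBondConfig ω') (γ : List MedialVertex) :
    IsMedialExploration E ω γ ↔ IsMedialExploration E ω' γ := by
  constructor
  · intro hγ
    exact { ne_nil := hγ.ne_nil, step := hγ.step, turn := h ▸ hγ.turn, nodup := hγ.nodup,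
            head_mem := hγ.head_mem, getLast_mem := hγ.getLast_mem,
            head_ne_getLast := hγ.head_ne_getLast, start := hγ.start }
  · intro hγ
    exact { ne_nil := hγ.ne_nil, step := hγ.step, turn := h.symm ▸ hγ.turn, nodup := hγ.nodup,
            head_mem := hγ.head_mem, getLast_mem := hγ.getLast_mem,
            head_ne_getLast := hγ.head_ne_getLast, start := hγ.start }

/-- Hence so does G02's exploration path (junk branch included). [folklore] -/
theorem medialExploration_congr (E : DiscreteDobrushin) {ω ω' : BondConfig (Site 2)}
    (h : E.bcBondConfig ω = E.bcBondConfig ω') :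
    medialExploration E ω = medialExploration E ω' := by
  classical
  have hP : IsMedialExploration E ω = IsMedialExploration E ω' :=
    funext fun γ => propext (isMedialExploration_congr E h γ)
  unfold medialExploration
  exact congrArg (fun P : List MedialVertex → Prop =>
    if hp : ∃! γ, P γ then hp.exists.choose else ([] : List MedialVertex)) hP

/-- And so does the interface. [folklore] -/
theorem bondInterfaceIn_congr (D : DobrushinDomain) (E : DiscreteDobrushin)
    {ω ω' : BondConfig (Site 2)} (h : E.bcBondConfig ω = E.bcBondConfig ω') :
    bondInterfaceIn D E ω = bondInterfaceIn D E ω' := by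
  simp only [bondInterfaceIn_apply, medialExplorationCurve, medialExploration_congr E h]

/-- MEASURABILITY of the bond interface for data with finitely many domain edges: it factors
through the restriction `ω ↦ ω ∩ S` to the finite edge set `S` of `Ω_δ`, i.e. through the finite
measurable space `Set S`, on which every map is measurable. [folklore] -/
theorem measurable_bondInterfaceIn (D : DobrushinDomain) (E : DiscreteDobrushin)
    (hfin : (discreteDomainGraph E.Ω E.δ).edgeSet.Finite) :
    Measurable (bondInterfaceIn D E) := by
  set S := (discreteDomainGraph E.Ω E.δ).edgeSet with hSdef
  haveI : Finite S := hfin.to_subtype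
  let restr : BondConfig (Site 2) → Set S := fun ω => {e | (e : Sym2 (Site 2)) ∈ ω}
  let extd : Set S → BondConfig (Site 2) := fun c => {e | ∃ h : e ∈ S, (⟨e, h⟩ : S) ∈ c}
  have hrestr : Measurable restr := measurable_set_iff.2 fun e => measurable_set_mem _
  have hext : ∀ ω, extd (restr ω) = ω ∩ S := by
    intro ω; ext e
    simp only [extd, restr, Set.mem_setOf_eq, Set.mem_inter_iff]
    constructor
    · rintro ⟨h, h'⟩; exact ⟨h', h⟩
    · rintro ⟨h', h⟩; exact ⟨h, h'⟩
  have hfac : bondInterfaceIn D E = (fun c => bondInterfaceIn D E (extd c)) ∘ restr := by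
    funext ω
    simp only [Function.comp_apply, hext]
    exact bondInterfaceIn_congr D E (bcBondConfig_inter_eq E subset_rfl ω).symm
  rw [hfac]
  exact (measurable_of_finite _).comp hrestr

/-- **Clause (i) of `LagHandOff` holds OUTRIGHT** (no hypothesis): for a discretisation family of a
(bounded) Dobrushin domain the interface is measurable at every positive mesh.  So the entire
weight of the crux is clause (ii). [folklore] -/
theorem lagHandOff_clause_i (D : DobrushinDomain) (E : ℝ → DiscreteDobrushin)
    (hE : ZdDiscretisationFamily D E) :
    ∀ᶠ δ in nhdsWithin (0 : ℝ) (Set.Ioi 0),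
      AEMeasurable (bondInterfaceIn D (E δ)) (bondPercolation (zdGraph 2) half) := by
  refine eventually_nhdsWithin_of_forall fun δ (hδ : 0 < δ) => ?_
  refine (measurable_bondInterfaceIn D (E δ) ?_).aemeasurable
  have hV : (meshDomain (E δ).Ω (E δ).δ).Finite := hE.meshDomain_finite hδ
  refine ((hV.prod hV).image (fun p : Site 2 × Site 2 => s(p.1, p.2))).subset ?_
  intro e he
  induction e using Sym2.ind with
  | _ x y =>
    have hadj := (SimpleGraph.mem_edgeSet _).1 he
    have h := discreteDomainGraph_adj_iff.1 hadj
    exact ⟨(x, y), ⟨h.2.1, h.2.2⟩, rfl⟩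

/-! ### Logical shape: the crux is `RotationInput → ScaleInvariantLimits → clause (ii)` -/

/-- **The crux reduced to clause (ii)**: since clause (i) is a theorem, `LagHandOff` is literally
`RotationInput → ScaleInvariantLimits → (ii)`. [folklore] -/
theorem lagHandOff_iff_clauseII :
    LagHandOff ↔ (RotationInput → ScaleInvariantLimits →
      ∀ δs : ℕ → ℝ, (∀ n, 0 < δs n) → Tendsto δs atTop (𝓝 0) →
        ∃ φ : ℕ → ℕ, StrictMono φ ∧ ∃ P : ChordalFamily, IsLocalMarkovChordalFamily P ∧
          (∀ D : DobrushinDomain, ∀ᵐ γ ∂(P D), ∀ c : Curve ℂ, CurveClass.mk c = γ →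
            ∀ s t : unitInterval, s < t → c '' Set.Icc s t ⊆ frontier D.carrier →
              (c '' Set.Icc s t).Subsingleton) ∧
          (∀ (D : DobrushinDomain) (E : ℝ → DiscreteDobrushin), ZdDiscretisationFamily D E →
            ∀ f : BoundedContinuousFunction (CurveClass ℂ) ℝ,
              Tendsto (fun n => ∫ ω, f (bondInterfaceIn D (E (δs (φ n))) ω)
                ∂(bondPercolation (zdGraph 2) half)) atTop (𝓝 (∫ γ, f γ ∂(P D))))) := by
  refine imp_congr_right fun _ => imp_congr_right fun _ => ?_
  exact ⟨fun h => h.2, fun h => ⟨fun D E hE => lagHandOff_clause_i D E hE, h⟩⟩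

/-- **OBSTRUCTION TO DISPROOF.**  Refuting the crux means PROVING both antecedents — DKKMO
rotation invariance in `ℋ`-form and dilation invariance of every subsequential quad-crossing limit
of bond-`ℤ²` (the open scale-invariance problem, the route's own target `ScaleInvariantLimits`) —
and refuting clause (ii). [folklore] -/
theorem not_lagHandOff_iff_clauseII :
    ¬ LagHandOff ↔ (RotationInput ∧ ScaleInvariantLimits ∧
      ¬ ∀ δs : ℕ → ℝ, (∀ n, 0 < δs n) → Tendsto δs atTop (𝓝 0) →
        ∃ φ : ℕ → ℕ, StrictMono φ ∧ ∃ P : ChordalFamily, IsLocalMarkovChordalFamily P ∧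
          (∀ D : DobrushinDomain, ∀ᵐ γ ∂(P D), ∀ c : Curve ℂ, CurveClass.mk c = γ →
            ∀ s t : unitInterval, s < t → c '' Set.Icc s t ⊆ frontier D.carrier →
              (c '' Set.Icc s t).Subsingleton) ∧
          (∀ (D : DobrushinDomain) (E : ℝ → DiscreteDobrushin), ZdDiscretisationFamily D E →
            ∀ f : BoundedContinuousFunction (CurveClass ℂ) ℝ,
              Tendsto (fun n => ∫ ω, f (bondInterfaceIn D (E (δs (φ n))) ω)
                ∂(bondPercolation (zdGraph 2) half)) atTop (𝓝 (∫ γ, f γ ∂(P D))))) := by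
  rw [lagHandOff_iff_clauseII]; tauto

/-! ### The vacuity channels of the antecedents, and their closure by theorems -/

/-- The zero law on `ℋ_ℂ` is invariant under every Euclidean motion (push-forward of `0`). [folklore] -/
theorem isometryLaw_zero (g : ℂ ≃ᵢ ℂ) : isometryLaw g 0 = 0 := by
  apply Subtype.ext
  simp [isometryLaw, FiniteMeasure.toMeasure_map]

/-- The zero law on `ℋ_ℂ` is invariant under every dilation. [folklore] -/
theorem dilateLaw_zero (t : ℝ) (ht : t ≠ 0) : dilateLaw t ht 0 = 0 := by
  apply Subtype.ext
  simp [dilateLaw, FiniteMeasure.toMeasure_map]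

/-- JUNK CHANNEL 1: were `Λ = subseqQuadLimits univ` empty, both antecedents of the crux would hold
vacuously (and the crux would collapse to its bare conclusion). [folklore] -/
theorem rotationInput_and_scaleInvariantLimits_of_eq_empty
    (h : subseqQuadLimits (Set.univ : Set ℂ) = ∅) : RotationInput ∧ ScaleInvariantLimits := by
  constructor
  · intro μ hμ; rw [h] at hμ; exact hμ.elim
  · intro μ hμ; rw [h] at hμ; exact hμ.elim

/-- JUNK CHANNEL 2: were every subsequential limit the zero law (which is what all the laws
`μ_δ = map (configOf …) P` would be, were `configOf` not a.e.-measurable), both antecedents would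
hold trivially. [folklore] -/
theorem rotationInput_and_scaleInvariantLimits_of_forall_eq_zero
    (h : ∀ μ ∈ subseqQuadLimits (Set.univ : Set ℂ), μ = 0) :
    RotationInput ∧ ScaleInvariantLimits := by
  constructor
  · intro μ hμ α; rw [h μ hμ]; exact isometryLaw_zero _
  · intro μ hμ t ht; rw [h μ hμ]; exact dilateLaw_zero t ht.ne'

/-- **CHANNEL 1 CLOSED: `Λ ≠ ∅`.**  Bond-`ℤ²` has subsequential quad-crossing scaling limits
(Schramm–Smirnov Cor. 1.6; the landed `exists_mem_subseqQuadLimits_tendsto_subseq` of stub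
`stub_quadCompactness`, applied to `δₙ = 1/(n+1)`). [folklore] -/
theorem subseqQuadLimits_nonempty : (subseqQuadLimits (Set.univ : Set ℂ)).Nonempty := by
  obtain ⟨φ, -, μ, hμ, -⟩ :=
    Cruxes.LagHandOff.CrosscutDictionary.exists_mem_subseqQuadLimits_tendsto_subseq
      (fun n => 1 / ((n : ℝ) + 1)) (fun n => by positivity) tendsto_one_div_add_atTop_nhds_zero_nat
  exact ⟨μ, hμ⟩

/-- **CHANNEL 2 CLOSED**: every subsequential limit is a probability measure
(`isProbabilityMeasure_of_isSubseqQuadLimit`), in particular not the zero law. [folklore] -/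
theorem ne_zero_of_mem_subseqQuadLimits {μ : FiniteMeasure (QuadConfig (Set.univ : Set ℂ))}
    (hμ : μ ∈ subseqQuadLimits (Set.univ : Set ℂ)) : μ ≠ 0 := by
  intro h
  haveI := isProbabilityMeasure_of_isSubseqQuadLimit isOpen_univ hμ
  have h1 : (μ : Measure (QuadConfig (Set.univ : Set ℂ))) Set.univ = 1 := measure_univ
  rw [h] at h1
  simp at h1

/-- The hypothesis of junk channel 1 is FALSE. [folklore] -/
theorem subseqQuadLimits_ne_empty : subseqQuadLimits (Set.univ : Set ℂ) ≠ ∅ :=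
  subseqQuadLimits_nonempty.ne_empty

/-- The hypothesis of junk channel 2 is FALSE. [folklore] -/
theorem not_forall_mem_subseqQuadLimits_eq_zero :
    ¬ (∀ μ ∈ subseqQuadLimits (Set.univ : Set ℂ), μ = 0) := fun h => by
  obtain ⟨μ, hμ⟩ := subseqQuadLimits_nonempty
  exact ne_zero_of_mem_subseqQuadLimits hμ (h μ hμ)

/-- `Λ` contains a probability measure: the antecedents quantify over genuine laws. [folklore] -/
theorem exists_isProbabilityMeasure_mem_subseqQuadLimits :
    ∃ μ ∈ subseqQuadLimits (Set.univ : Set ℂ),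
      IsProbabilityMeasure (μ : Measure (QuadConfig (Set.univ : Set ℂ))) := by
  obtain ⟨μ, hμ⟩ := subseqQuadLimits_nonempty
  exact ⟨μ, hμ, isProbabilityMeasure_of_isSubseqQuadLimit isOpen_univ hμ⟩

/-! ### The no-tracing clause has teeth -/

/-- The boundary-running test family `ChordalFamily.arcFamily` (chordal and similarity covariant)
VIOLATES the no-tracing clause of (ii) in every Dobrushin domain: its curve is the arc
`(ab) ⊆ ∂D`, which contains the two distinct points `a`, `b`. [folklore] -/
theorem arcFamily_violates_noTracing (D : DobrushinDomain) :
    ¬ (∀ᵐ γ ∂(ChordalFamily.arcFamily D), ∀ c : Curve ℂ, CurveClass.mk c = γ →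
        ∀ s t : unitInterval, s < t → c '' Set.Icc s t ⊆ frontier D.carrier →
          (c '' Set.Icc s t).Subsingleton) := by
  intro h
  rw [ChordalFamily.arcFamily, ae_dirac_eq, eventually_pure] at h
  have hsub : (D.arcCurve 0 : Curve ℂ) '' Set.Icc (0 : unitInterval) 1 ⊆ frontier D.carrier := by
    rintro _ ⟨s, -, rfl⟩
    exact D.arc_subset_frontier 0 (D.range_arcCurve_subset 0 ⟨s, rfl⟩)
  have h1 := h (D.arcCurve 0) rfl 0 1 zero_lt_one hsub
  have ha : D.pt 0 ∈ (D.arcCurve 0 : Curve ℂ) '' Set.Icc (0 : unitInterval) 1 :=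
    ⟨0, ⟨le_rfl, zero_le_one⟩, by simpa [Curve.source_def] using D.source_arcCurve 0⟩
  have hb : D.pt 1 ∈ (D.arcCurve 0 : Curve ℂ) '' Set.Icc (0 : unitInterval) 1 :=
    ⟨1, ⟨zero_le_one, le_rfl⟩, by simpa [Curve.target_def] using D.target_arcCurve 0⟩
  exact D.pt_injective.ne (by decide : (0 : Fin 2) ≠ 1) (h1 ha hb)
end Summit.CriticalPhenomena.CardyFormulaZ2.Theorems.LagHandOff.Negative

end
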